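import Summits.QuantumFields.BalabanUV.Beta.WardLocusStencils
import Literature.MathematicalPhysics.QuantumFieldTheory.Balaban1983to89.Beta.BalabanStepJetsSucc
import Literature.MathematicalPhysics.QuantumFieldTheory.Balaban1983to89.Beta.InterLevelTransport

/-!
# `BalabanUV.Beta.FP.TraceUnlift` — road «FP» for binder row D1, row **N2a-ENG**, input (4) «trace bookkeeping … UN-LIFTING
# `tr_fine (liftW n K ∘ X) = tr_coarse (K ∘ unlift X)` (to be typed)» (owner d1-p3 g12, `LEAVES-FP.md` l.557, file name `FP/TraceUnlift.lean` as booked there):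
# THE FINE TRACE OF A WORD BEGINNING WITH A WEIGHTED LIFT IS THE COARSE TRACE OF THE LIFTED KERNEL AGAINST THE `mm`-READ OF THE REST — generic `d`, `M`

HONEST DEPENDENCY (page 1, mandatory): continuum YM on T⁴ ⇐ BetaPertH ∧ nine spine estimates (0/9 proved); BetaPertH ⇐ (D1) ∧ (D4) ∧ CAP+tail;
G-an2-4 gates asym, D1 and NE2/3/4.  HONEST FRAMING (cell contract, verbatim): «discharging `BetaPertH` makes Bałaban's UV stability UNCONDITIONAL —
a real constructive-QFT result; it is NOT the continuum limit and NOT the Clay problem.»  THIS MODULE is [folklore] lattice-sum bookkeeping (sublattice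
re-indexing of unconditional `tsum`s) over an4∕an5's `InterLevelTransport.liftW` ∕ `lift`, an2's `BalabanStepJetsSucc.mmRead` and `WardLocusStencils.ffK`;
no `def`, no `def … : Prop`, nothing cited, 0 sorry, NO summability hypothesis.  0∕4 row-D1 binders; NOT N2a, NOT SDF, NOT D1, NOT BetaPertH, NOT continuum,
NOT Clay.  «not in print; our bookkeeping».

ABSOLUTE RULE (cell charter, verbatim): «No internally-minted statement may enter as a cited fact. Every hypothesis is either kernel-proved in this package or a
verbatim quotation of a PUBLISHED theorem with page reference. The manuscript(s) under audit are NOT citable for their own disputed steps — they are the thing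
under adjudication; programme-internal (2001/route/tribunal) claims are never citable.»

WHY (owner d1-p3 g12, `JETS-JM-DESIGN.md` v2 §4, row N2a-ENG input (4)): the one-loop Fubini expansion at the perfect objects meets, inside its traces, the
m-fold resolvent lifted to the fine lattice — `liftW Lc true true (KPerf m)` in the two-level split of `KPerf (m+1)` (`PerfectTelescopingHolds`, MS-1-BOT) —
and must read such words back on the COARSE lattice where the jets of record live.  This file is the un-lifting rule: bring the lift to the front (trace
cyclicity, an2's `KernelWard.tr_comp_comm_bb` ∕ `TameKernelCalculus.tr_comp_comm_loc` — NOT here) and then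
`tr (liftW M s t K ∘ X) = s_s·s_t · Σ'_{x′} Σ_κ Σ'_{y′} Σ_l K x′ y′ (slot s κ) (slot t l) · X (M•y′) (M•x′) (inr l) (inr κ)`; for two FIELD slots
(`s = t = true`, the case MS-1-BOT uses) the right side is `s_tt² · tr (ffK K ∘ mmRead M X)` — the coarse trace of the lifted kernel's field block against
an2's `mm`-READ of the rest of the word.

CONTENT ([folklore]; generic `d`, `[NeZero M]`; every identity UNCONDITIONAL — both sides are `tsum`s and only the injective re-indexing `x′ ↦ M•x′`
(`InterLevelTransport.tsum_sublattice`) is used).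
* §1 `lift_inr_inr` (the defining `if`), `sum_liftW_mul_inl` ∕ `sum_liftW_mul_inr` (the fibre sum of `liftW M s t K x y a · ∗ X y x · a` at `a = inl α` is `0`,
  at `a = inr κ` is the sublattice indicator times `s_s·s_t·Σ_l K (quo x) (quo y) (slot s κ) (slot t l) · X y x (inr l) (inr κ)`).
* §2 **`tr_comp_liftW`** (the un-lifting rule above), **`tr_comp_liftW_true_true`** (`= (s_tt·s_tt) · tr (comp (ffK K) (mmRead M X))`),
  `tadpole_liftW_true_true` (the same in an2's `tadpole` notation).
NOT HERE: cyclicity (landed, with its summability letters); the `bubble` words of N2a (they reduce to these after cyclicity); any estimate.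
Provenance: D1 formalisation swarm LEAF PROVER 06, unit b2b-balaban-beta-d1-formalise-leaf-06 gen 13, 2026-08-21 (INTENT 2 journal); no existing file touched.
-/

noncomputable section

open Finset
open scoped BigOperators
open Literature.MathematicalPhysics.QuantumFieldTheory
open Literature.MathematicalPhysics.QuantumFieldTheory.Balaban1983to89
open Literature.MathematicalPhysics.QuantumFieldTheory.Balaban1983to89.Beta
open Literature.Probability.LatticeModels (Torus.proj)
open LatticeForm (quo)
open ExpKernelCalculus (MKer tr comp tadpole)
open OneStepResolventKernel (Fib proj_zsmul quo_zsmul eq_zsmul_quo_of_proj)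
open InterLevelTransport (slot slotW lift liftW liftW_inl_left liftW_inl_right tsum_sublattice)
open BalabanStepJetsSucc (mmRead)
open Summit.QuantumFields.BalabanUV.Beta.WardLocusStencils (ffK)

namespace Summit.QuantumFields.BalabanUV.Beta.FP.TraceUnlift

variable {d : ℕ} (M : ℕ) [NeZero M] (s t : Bool) (K X : MKer (d + 1) (Fib d))

/-! ## §1 The fibre sums of `liftW · X` at a fixed pair of sites -/

omit [NeZero M] in
/-- [folklore] The defining `if` of the lift on the `(inr, inr)` block. -/
theorem lift_inr_inr (x y : Fin (d + 1) → ℤ) (κ l : Fin (d + 1)) :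
    lift M s t K x y (Sum.inr κ) (Sum.inr l) =
      if Torus.proj M x = 0 ∧ Torus.proj M y = 0 then K (quo M x) (quo M y) (slot s κ) (slot t l) else 0 := rfl

omit [NeZero M] in
/-- [folklore] At a FIELD left slot the lifted kernel contributes nothing: `Σ_f liftW … x y (inl α) f · X y x f (inl α) = 0`. -/
theorem sum_liftW_mul_inl (x y : Fin (d + 1) → ℤ) (α : Fin (d + 1)) :
    (∑ f : Fib d, liftW M s t K x y (Sum.inl α) f * X y x f (Sum.inl α)) = 0 :=
  Finset.sum_eq_zero fun f _ => by rw [liftW_inl_left, zero_mul]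

omit [NeZero M] in
/-- [folklore] At a MULTIPLIER left slot: `Σ_f liftW M s t K x y (inr κ) f · X y x f (inr κ)` is the sublattice indicator of `(x, y)` times
`s_s·s_t · Σ_l K (quo x) (quo y) (slot s κ) (slot t l) · X y x (inr l) (inr κ)`. -/
theorem sum_liftW_mul_inr (x y : Fin (d + 1) → ℤ) (κ : Fin (d + 1)) :
    (∑ f : Fib d, liftW M s t K x y (Sum.inr κ) f * X y x f (Sum.inr κ)) =
      if Torus.proj M x = 0 ∧ Torus.proj M y = 0 then
        slotW d M s * slotW d M t * ∑ l : Fin (d + 1), K (quo M x) (quo M y) (slot s κ) (slot t l) * X y x (Sum.inr l) (Sum.inr κ)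
      else 0 := by
  rw [Fintype.sum_sum_type]
  have h1 : (∑ l : Fin (d + 1), liftW M s t K x y (Sum.inr κ) (Sum.inl l) * X y x (Sum.inl l) (Sum.inr κ)) = 0 :=
    Finset.sum_eq_zero fun l _ => by rw [liftW_inl_right, zero_mul]
  rw [h1, zero_add]
  by_cases h : Torus.proj M x = 0 ∧ Torus.proj M y = 0
  · rw [if_pos h, Finset.mul_sum]
    refine Finset.sum_congr rfl fun l _ => ?_
    simp only [liftW, lift_inr_inr, if_pos h]
    ring
  · rw [if_neg h]
    exact Finset.sum_eq_zero fun l _ => by simp only [liftW, lift_inr_inr, if_neg h, mul_zero, zero_mul]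

/-! ## §2 The un-lifting rule for traces -/

/-- [folklore] **THE UN-LIFTING RULE**: the fine trace of `liftW M s t K ∘ X` is the coarse double sum of the lifted block of `K` against `X` read at the
sublattice points in the multiplier slots — `tr (comp (liftW M s t K) X) = s_s·s_t · Σ'_{x′} Σ_κ Σ'_{y′} Σ_l K x′ y′ (slot s κ) (slot t l) · X (M•y′) (M•x′) (inr l) (inr κ)`.
UNCONDITIONAL (two sublattice re-indexings `InterLevelTransport.tsum_sublattice` of unconditional `tsum`s). -/
theorem tr_comp_liftW :
    tr (comp (liftW M s t K) X) = slotW d M s * slotW d M t *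
      ∑' x' : Fin (d + 1) → ℤ, ∑ κ : Fin (d + 1), ∑' y' : Fin (d + 1) → ℤ, ∑ l : Fin (d + 1),
        K x' y' (slot s κ) (slot t l) * X ((M : ℤ) • y') ((M : ℤ) • x') (Sum.inr l) (Sum.inr κ) := by
  -- the inner coarse function at a fine left point `x`
  set g : (Fin (d + 1) → ℤ) → (Fin (d + 1) → ℤ) → Fin (d + 1) → ℝ := fun x y' κ =>
    ∑ l : Fin (d + 1), K (quo M x) y' (slot s κ) (slot t l) * X ((M : ℤ) • y') x (Sum.inr l) (Sum.inr κ) with hg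
  -- step 1: the middle sum of `comp` runs over the sublattice
  have hmid : ∀ (x : Fin (d + 1) → ℤ) (κ : Fin (d + 1)),
      (∑' y, ∑ f : Fib d, liftW M s t K x y (Sum.inr κ) f * X y x f (Sum.inr κ)) =
        if Torus.proj M x = 0 then slotW d M s * slotW d M t * ∑' y', g x y' κ else 0 := by
    intro x κ
    by_cases hx : Torus.proj M x = 0
    · rw [if_pos hx, ← tsum_mul_left, ← tsum_sublattice M 0 (fun y' => slotW d M s * slotW d M t * g x y' κ)]
      refine tsum_congr fun y => ?_
      rw [sum_liftW_mul_inr, sub_zero]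
      by_cases hy : Torus.proj M y = 0
      · rw [if_pos ⟨hx, hy⟩, if_pos hy, hg]
        congr 1
        refine Finset.sum_congr rfl fun l _ => ?_
        rw [← eq_zsmul_quo_of_proj (N := M) hy]
      · rw [if_neg (fun h => hy h.2), if_neg hy]
    · rw [if_neg hx]
      simp only [sum_liftW_mul_inr, hx, false_and, if_false, tsum_zero]
  -- step 2: the outer sum of `tr` runs over the sublattice
  unfold ExpKernelCalculus.tr ExpKernelCalculus.comp
  set G : (Fin (d + 1) → ℤ) → ℝ := fun x' => slotW d M s * slotW d M t * ∑ κ : Fin (d + 1), ∑' y', ∑ l : Fin (d + 1),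
    K x' y' (slot s κ) (slot t l) * X ((M : ℤ) • y') ((M : ℤ) • x') (Sum.inr l) (Sum.inr κ) with hG
  have hout : ∀ x : Fin (d + 1) → ℤ,
      (∑ a : Fib d, ∑' y, ∑ f : Fib d, liftW M s t K x y a f * X y x f a) =
        if Torus.proj M (x - 0) = 0 then G (quo M (x - 0)) else 0 := by
    intro x
    rw [sub_zero, Fintype.sum_sum_type, hG]
    have h1 : (∑ α : Fin (d + 1), ∑' y, ∑ f : Fib d, liftW M s t K x y (Sum.inl α) f * X y x f (Sum.inl α)) = 0 :=
      Finset.sum_eq_zero fun α _ => by simp only [sum_liftW_mul_inl, tsum_zero]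
    rw [h1, zero_add]
    by_cases hx : Torus.proj M x = 0
    · simp only [hmid, if_pos hx, ← Finset.mul_sum]
      congr 1
      refine Finset.sum_congr rfl fun κ _ => tsum_congr fun y' => ?_
      rw [hg]
      refine Finset.sum_congr rfl fun l _ => ?_
      rw [← eq_zsmul_quo_of_proj (N := M) hx]
    · simp only [hmid, if_neg hx, Finset.sum_const_zero]
  rw [tsum_congr hout, tsum_sublattice M 0 G, hG, tsum_mul_left]

/-- [folklore] **TWO FIELD SLOTS — THE CASE THE (STEP) DOOR USES** (`liftW Lc true true (KPerf m)`): the fine trace of `liftW M true true K ∘ X` is the COARSE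
trace of the field block of `K` against an2's `mm`-READ of `X`: `tr (comp (liftW M true true K) X) = (s_tt·s_tt) · tr (comp (ffK K) (mmRead M X))`. -/
theorem tr_comp_liftW_true_true :
    tr (comp (liftW M true true K) X) = (slotW d M true * slotW d M true) * tr (comp (ffK K) (mmRead M X)) := by
  rw [tr_comp_liftW]
  unfold ExpKernelCalculus.tr ExpKernelCalculus.comp
  congr 1
  refine tsum_congr fun x' => ?_
  rw [Fintype.sum_sum_type]
  have h0 : (∑ μ : Fin (d + 1), ∑' y', ∑ f : Fib d, ffK K x' y' (Sum.inr μ) f * mmRead M X y' x' f (Sum.inr μ)) = 0 :=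
    Finset.sum_eq_zero fun μ _ => by
      have : ∀ y', (∑ f : Fib d, ffK K x' y' (Sum.inr μ) f * mmRead M X y' x' f (Sum.inr μ)) = 0 := fun y' =>
        Finset.sum_eq_zero fun f _ => by cases f <;> simp [ffK]
      simp only [this, tsum_zero]
  rw [h0, add_zero]
  refine Finset.sum_congr rfl fun κ _ => tsum_congr fun y' => ?_
  rw [Fintype.sum_sum_type]
  have h1 : (∑ μ : Fin (d + 1), ffK K x' y' (Sum.inl κ) (Sum.inr μ) * mmRead M X y' x' (Sum.inr μ) (Sum.inl κ)) = 0 :=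
    Finset.sum_eq_zero fun μ _ => by simp [ffK]
  rw [h1, add_zero]
  refine Finset.sum_congr rfl fun l _ => ?_
  simp only [slot, if_true, ffK, mmRead]

/-- [folklore] The same in an2's `tadpole` notation: `tadpole (liftW M true true K) W = (s_tt·s_tt) · tadpole (ffK K) (mmRead M W)`. -/
theorem tadpole_liftW_true_true (W : MKer (d + 1) (Fib d)) :
    tadpole (liftW M true true K) W = (slotW d M true * slotW d M true) * tadpole (ffK K) (mmRead M W) :=
  tr_comp_liftW_true_true M K W

end Summit.QuantumFields.BalabanUV.Beta.FP.TraceUnlift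

end
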